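import Mathlib
import HarnessLib
import Summits.Ventures.LatticeQCDFlow.Exactness.NCMCGeneralSpaceIndicatorCLT
import Summits.Ventures.LatticeQCDFlow.Exactness.NCMCGeneralSpaceEventTauIntPositive
import Summits.Ventures.LatticeQCDFlow.Exactness.NCMCGeneralSpaceOccupancyChainCLT
import Summits.Ventures.LatticeQCDFlow.Exactness.NCMCGeneralSpaceReplicaTStatisticIndep

/-!
# Event frequencies and the NCMC lane: the replica-`t` bar over `R ≥ 2` independent chains from ANY starts has limiting coverage `L_R(q)` UNCONDITIONALLY (no variance hypothesis — `τ_int > 0` for every event under a Doeblin power)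

HONEST FRAMING: exact (Metropolis-corrected) sampling algorithms for lattice gauge theory;
figures of merit are autocorrelation/cost numbers at stated couplings and volumes; no
continuum-physics claim.

Venture `LatticeQCDFlow` (cell pub-lqcd), topic `Exactness`; FANOUT row 13 (`eng-snf`, GEN-24).  NEW
WORK of the cell — composition of GEN-19/21 `tendstoInDistribution_indicator_timeAverage_of_nHit`
(the CLT of an event frequency along one chain from any start), GEN-21
`tauInt_setACF_pos_of_nHit` (every non-trivial event has `τ_int > 0` under a Doeblin power), GEN-23
I `tendsto_measure_abs_studentised_le_of_indep` and, for the NCMC instance, the expanded-ensemble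
chain of `NCMCGeneralSpaceOccupancyChainCLT`.  No definition; nothing cited as a fact.

WHY (row 13).  The replica-`t` / jackknife bar's universal limiting coverage `L_R(q)` (GEN-23 K4,
GEN-24 `NCMCGeneralSpaceReplicaTStatisticStudent`: Student's ratio probability) needs `σ²_f > 0`.
For EVENT FREQUENCIES — the NCMC lane's `target_means` (occupancy of the target level), switch
acceptance rates, indicator diagnostics — that hypothesis is AUTOMATIC: GEN-21 proved
`τ_int(ρ_A) > 0` for every event with `0 < π(A) < 1` under any Doeblin power.  So the engine's
`run_ncmc_chain` over a batch of `B ≥ 2` replicas started from ANY initial states reports a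
`target_means ± q·ŝe_JK` bar whose coverage tends to `L_B(q)` with no further assumption.

## Content
* **`tendsto_measure_abs_indicatorReplicaT_le_of_nHit`** (§1) — `κ` Markov, `π` invariant,
  `(nHit κ m)(z,·) ≥ ε ν` (`ε ≠ 0`, `0 < m`), `A` measurable with `0 < π(A) < 1`, `R ≥ 2`
  independent chains with ANY initial laws, `q ≥ 0`: `P(|t_n(p̂)| ≤ q) → L_R(q)`.
* **`CrooksPair.ncmc_targetMeans_replicaT_of_sq`** (§2) — the NCMC lane (Crooks pair, `T₀, T₁`
  leaving `ν₀, ν₁` invariant, two-step certificate `ε • ν ≤ (nHit Q 2)(z,·)`, `e^{−ΔF} = Z₁/Z₀`), `R ≥ 2`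
  replicas from ANY initial states `z_r`: the `target_means` replica-`t` bar around `σ(c − ΔF)` has
  limiting coverage `L_R(q)`.

NOT CLAIMED: the logit (`dF_occ`) form of the bar (delta method per replica — routine, not filed);
dependent replicas; anything numerical.
-/

namespace Summit.Ventures.LatticeQCDFlow.Exactness.GeneralNCMC

open MeasureTheory ProbabilityTheory Set Filter Finset
open scoped ENNReal NNReal Topology

/-! ## §1 Event frequencies along any Doeblin-power chain -/

section Event

variable {S : Type*} [MeasurableSpace S]
  {κ : Kernel S S} [IsMarkovKernel κ] {π : Measure S} [IsProbabilityMeasure π]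
  {ν : Measure S} [IsProbabilityMeasure ν] {ε : ℝ≥0∞} {m : ℕ}
  {ι : Type*} [Fintype ι] [Nontrivial ι]

/-- **THE REPLICA-`t` BAR OF AN EVENT FREQUENCY HAS LIMITING COVERAGE `L_R(q)`, UNCONDITIONALLY.**
`κ` Markov, `π` invariant, `(nHit κ m)(z, ·) ≥ ε ν` (`ε ≠ 0`, `0 < m`), `A` measurable with
`0 < π(A) < 1`; `R = card ι ≥ 2` INDEPENDENT chains with ANY initial laws `μ_r`; `q ≥ 0`.  With
`p̂_{r,n}` the frequency of `A` along replica `r`: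
`P(|((1/R)Σ_r p̂_{r,n} − π(A))/√(Σ_r (p̂_{r,n} − p̄̂_n)²/(R(R−1)))| ≤ q) → N(0,1)^{⊗R}{|t| ≤ q}`. -/
theorem tendsto_measure_abs_indicatorReplicaT_le_of_nHit (hπ : Kernel.Invariant κ π) (hε : ε ≠ 0)
    (hmin : ∀ z, ε • ν ≤ nHit κ m z) (hm : 0 < m)
    {A : Set S} (hA : MeasurableSet A) (h0 : 0 < π.real A) (h1 : π.real A < 1)
    (μ : ι → Measure S) [∀ r, IsProbabilityMeasure (μ r)]
    [∀ r, IsProbabilityMeasure (Kernel.trajMeasure (X := fun _ : ℕ => S) (μ r)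
        (fun n : ℕ => κ.comap (fun hh : (i : ↥(Finset.Iic n)) → S => hh ⟨n, Finset.mem_Iic.2 le_rfl⟩)
          (measurable_pi_apply _)))] {q : ℝ} (hq : 0 ≤ q) :
    Tendsto (fun n : ℕ => (Measure.pi fun r => Kernel.trajMeasure (X := fun _ : ℕ => S) (μ r)
        (fun n : ℕ => κ.comap (fun hh : (i : ↥(Finset.Iic n)) → S => hh ⟨n, Finset.mem_Iic.2 le_rfl⟩)
          (measurable_pi_apply _)))
        {x : ι → ℕ → S |
          |((∑ r, (∑ t ∈ range n, A.indicator (1 : S → ℝ) (x r t)) / n) / Fintype.card ι - π.real A)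
            / Real.sqrt ((∑ r, ((∑ t ∈ range n, A.indicator (1 : S → ℝ) (x r t)) / n
                - (∑ r', (∑ t ∈ range n, A.indicator (1 : S → ℝ) (x r' t)) / n)
                  / Fintype.card ι) ^ 2)
              / ((Fintype.card ι : ℝ) * (Fintype.card ι - 1)))| ≤ q})
      atTop
      (𝓝 ((Measure.pi fun _ : ι => gaussianReal 0 1) {z : ι → ℝ | |(∑ r, z r) / Fintype.card ι
        / Real.sqrt ((∑ r, (z r - (∑ r', z r') / Fintype.card ι) ^ 2)
            / ((Fintype.card ι : ℝ) * (Fintype.card ι - 1)))| ≤ q})) := by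
  set v : ℝ≥0 := Real.toNNReal (2 * Scoring.tauInt (setACF κ π A) * (π.real A * (1 - π.real A)))
    with hv
  have hvpos : 0 < 2 * Scoring.tauInt (setACF κ π A) * (π.real A * (1 - π.real A)) := by
    have hτ := tauInt_setACF_pos_of_nHit hπ hε hmin hm hA h0 h1
    have hp : 0 < π.real A * (1 - π.real A) := mul_pos h0 (sub_pos.2 h1)
    positivity
  have hv0 : v ≠ 0 := by
    rw [hv, Ne, Real.toNNReal_eq_zero, not_le]
    exact hvpos
  have hclt : ∀ r : ι, TendstoInDistribution (fun (n : ℕ) (x : ℕ → S) =>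
        Real.sqrt (n : ℝ) * ((∑ t ∈ range n, A.indicator (1 : S → ℝ) (x t)) / n - π.real A))
      atTop id (fun _ => Kernel.trajMeasure (X := fun _ : ℕ => S) (μ r)
        (fun n : ℕ => κ.comap (fun hh : (i : ↥(Finset.Iic n)) → S => hh ⟨n, Finset.mem_Iic.2 le_rfl⟩)
          (measurable_pi_apply _))) (gaussianReal 0 v) := fun r =>
    tendstoInDistribution_indicator_timeAverage_of_nHit hπ hε hmin hm hA h0 h1 (μ r)
      (P' := gaussianReal 0 v) (Y := id) HasLaw.id
  have hmeas : ∀ n : ℕ, Measurable fun x : ℕ → S =>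
      (∑ t ∈ range n, A.indicator (1 : S → ℝ) (x t)) / n := fun n =>
    (Finset.measurable_sum _ fun t _ =>
      (measurable_one.indicator hA).comp (measurable_pi_apply t)).div_const _
  exact tendsto_measure_abs_studentised_le_of_indep (Ω := fun _ : ι => ℕ → S)
    (θhat := fun (_ : ι) (n : ℕ) (x : ℕ → S) => (∑ t ∈ range n, A.indicator (1 : S → ℝ) (x t)) / n)
    (fun _ n => hmeas n) (π.real A) hv0 hclt hq

end Event

/-! ## §2 The NCMC lane: `target_means ± jackknife` over replicas from any initial states -/

section NCMC

variable {Ω E : Type*} [MeasurableSpace Ω] [MeasurableSpace E]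
  {ν₀ ν₁ : Measure Ω} [IsFiniteMeasure ν₀] [IsFiniteMeasure ν₁]
  {κF κR : Kernel Ω E} [IsMarkovKernel κF] [IsMarkovKernel κR] {s e : E → Ω} {W : E → ℝ} {c : ℝ}
  {T₀ T₁ : Kernel Ω Ω} [IsMarkovKernel T₀] [IsMarkovKernel T₁] {ε : ℝ≥0∞}
  {ν : Measure (Bool × Ω)} [IsProbabilityMeasure ν]
  {ι : Type*} [Fintype ι] [Nontrivial ι]

/-- **THE NCMC LANE'S `target_means` REPLICA-`t` BAR HAS LIMITING COVERAGE `L_R(q)`, FROM ANY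
INITIAL STATES, UNCONDITIONALLY.**  Crooks pair, `T₀, T₁` leaving `ν₀, ν₁` invariant, two-step certificate
`ε • ν ≤ (nHit Q 2)(z, ·)` (`ε ≠ 0`) for `Q = switchKernel ∘ₖ levelKernel`, `e^{−ΔF} = Z₁/Z₀`;
`R = card ι ≥ 2` independent replicas started from ANY states `z_r`; `q ≥ 0`.  With `p̂_{r,n}` the
target-level occupancy of replica `r` and `σ = σ(c − ΔF)`:
`P(|((1/R)Σ_r p̂_{r,n} − σ)/√(Σ_r (p̂_{r,n} − p̄̂_n)²/(R(R−1)))| ≤ q) → N(0,1)^{⊗R}{|t| ≤ q}`. -/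
theorem CrooksPair.ncmc_targetMeans_replicaT_of_sq (h : CrooksPair ν₀ ν₁ κF κR s e W)
    (h0 : ν₀ univ ≠ 0) (h1 : ν₁ univ ≠ 0) (hT₀ : Kernel.Invariant T₀ ν₀)
    (hT₁ : Kernel.Invariant T₁ ν₁) (hε : ε ≠ 0)
    (hD : haveI := isMarkovKernel_switchKernel (κF := κF) (κR := κR) (c := c)
              h.measurable_W h.measurable_s h.measurable_e
      ∀ z, ε • ν ≤ nHit (switchKernel κF κR c W s e ∘ₖ levelKernel T₀ T₁) 2 z)
    {ΔF : ℝ} (hΔF : Real.exp (-ΔF) = ((ν₀ univ)⁻¹ * ν₁ univ).toReal) (z : ι → Bool × Ω)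
    [hP : haveI := isMarkovKernel_switchKernel (κF := κF) (κR := κR) (c := c)
              h.measurable_W h.measurable_s h.measurable_e
      haveI := isMarkovKernel_levelKernel T₀ T₁
      ∀ r, IsProbabilityMeasure (Kernel.trajMeasure (X := fun _ : ℕ => Bool × Ω)
        (Measure.dirac (z r))
        (fun n : ℕ => (switchKernel κF κR c W s e ∘ₖ levelKernel T₀ T₁).comap
          (fun hh : (j : ↥(Finset.Iic n)) → Bool × Ω => hh ⟨n, Finset.mem_Iic.2 le_rfl⟩)
          (measurable_pi_apply _)))] {q : ℝ} (hq : 0 ≤ q) :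
    haveI := isMarkovKernel_switchKernel (κF := κF) (κR := κR) (c := c)
      h.measurable_W h.measurable_s h.measurable_e
    haveI := isMarkovKernel_levelKernel T₀ T₁
    Tendsto (fun n : ℕ => (Measure.pi fun r => Kernel.trajMeasure (X := fun _ : ℕ => Bool × Ω)
        (Measure.dirac (z r))
        (fun n : ℕ => (switchKernel κF κR c W s e ∘ₖ levelKernel T₀ T₁).comap
          (fun hh : (j : ↥(Finset.Iic n)) → Bool × Ω => hh ⟨n, Finset.mem_Iic.2 le_rfl⟩)
          (measurable_pi_apply _)))
        {x : ι → ℕ → Bool × Ω |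
          |((∑ r, (∑ i ∈ range n, (targetLevel Ω).indicator (1 : Bool × Ω → ℝ) (x r i)) / n)
              / Fintype.card ι - Real.sigmoid (c - ΔF))
            / Real.sqrt ((∑ r,
                ((∑ i ∈ range n, (targetLevel Ω).indicator (1 : Bool × Ω → ℝ) (x r i)) / n
                  - (∑ r', (∑ i ∈ range n, (targetLevel Ω).indicator (1 : Bool × Ω → ℝ) (x r' i)) / n)
                    / Fintype.card ι) ^ 2)
              / ((Fintype.card ι : ℝ) * (Fintype.card ι - 1)))| ≤ q})
      atTop
      (𝓝 ((Measure.pi fun _ : ι => gaussianReal 0 1) {y : ι → ℝ | |(∑ r, y r) / Fintype.card ι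
        / Real.sqrt ((∑ r, (y r - (∑ r', y r') / Fintype.card ι) ^ 2)
            / ((Fintype.card ι : ℝ) * (Fintype.card ι - 1)))| ≤ q})) := by
  haveI := isMarkovKernel_switchKernel (κF := κF) (κR := κR) (c := c)
    h.measurable_W h.measurable_s h.measurable_e
  haveI := isMarkovKernel_levelKernel T₀ T₁
  haveI := isProbabilityMeasure_jointLaw c ν₀ ν₁ h0
  have hπ : Kernel.Invariant (switchKernel κF κR c W s e ∘ₖ levelKernel T₀ T₁)
      ((jointWeight c ν₀ ν₁ univ)⁻¹ • jointWeight c ν₀ ν₁) :=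
    invariant_smul _ (iteration_invariant h hT₀ hT₁ c) _
  have hσ := jointLaw_real_targetLevel c ν₀ ν₁ h0 h1 hΔF
  have hp0 : 0 < ((jointWeight c ν₀ ν₁ univ)⁻¹ • jointWeight c ν₀ ν₁).real (targetLevel Ω) := by
    rw [hσ]; exact Real.sigmoid_pos _
  have hp1 : ((jointWeight c ν₀ ν₁ univ)⁻¹ • jointWeight c ν₀ ν₁).real (targetLevel Ω) < 1 := by
    rw [hσ]; exact Real.sigmoid_lt_one _
  rw [← hσ]
  exact tendsto_measure_abs_indicatorReplicaT_le_of_nHit hπ hε hD (by norm_num)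
    measurableSet_targetLevel hp0 hp1 (fun r => Measure.dirac (z r)) hq

end NCMC

end Summit.Ventures.LatticeQCDFlow.Exactness.GeneralNCMC
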